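import Mathlib
import Summits.MatrixMultiplication.MatrixMultiplication.Theorems.SubgroupIdentityDesigns.Negative.RootSmear

/-!
# Weighted root smears: the full `(p-1)^{k+1}`-family of level-`k` annihilators on the root-smear pattern group
(negative lemma, crux `SubgroupIdentityDesigns`, 14079; generalises `Negative.RootSmear`)

Same pattern `Π(k,i,j)` and `ℓ`-positions as `Negative.RootSmear` (`k ≤ i < j < m`, 0-indexed), but the linear
form is now WEIGHTED: `ℓ_w(n) = Σ_{(a,b) ∈ ellPos} w_{ab} n_{ab}` for an arbitrary weight table `w` that is
NON-ZERO on the `ℓ`-positions.  Every such `ψ ∘ ℓ_w` is a linear character of the pattern group `Q = 1 + 𝔫_Π`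
which is non-trivial on all `k+1` simple-root coordinates ("generic"), and each one is a level-`k` annihilator:
* `rootSmearW_sum_eq_zero`: `Σ_e ψ(ℓ_w(n_e)) ψ(tr(M(1+n_e))) = 0` for every `M` of rank `≤ k` — the sum factorises
  as `ψ(tr M) Π_{(a,b)∈Π} p·[M_{ba} = −w_{ab}ε_{ab}]`, and on the support the `(k+1)×(k+1)` minor with rows
  `(0,…,k-1,j)` and columns `(1,…,k-1,j,i)` is lower triangular with diagonal entries `−w ≠ 0`
  (`succ_le_rank_of_smear_entriesW`);
* `rootSmearW_fourierMat_sum_eq_zero`, `no_idTest_of_rootSmearW`: as in the unweighted file.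
Restricting `w` to the `ℓ`-positions, these are `(p-1)^{k+1}` pairwise distinct linear characters of `Q`, hence
`(p-1)^{k+1}` linearly independent relations `Σ_q ψ(ℓ_w(q)) π_k(q) = 0` among the level-`k` permutation matrices
of `Q` — the lower-bound half of the completeness theorem of cell B2b-5 gen 2
(`run/shared/lean/b2b/levelgraded-cu/ORACLE-g2.md` §G3: these are ALL the relations; `Q ≅ U_{k+2}(𝔽_p)` and an
irreducible representation of `U_n` occurs in `ℂ[M_{n×(n−2)}]` iff it is not a generic linear character).
`w ≡ 1` recovers `Negative.RootSmear`.  Sorry-free; standard axioms.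
-/

set_option linter.dupNamespace false

noncomputable section

open scoped BigOperators Classical

namespace Summit.MatrixMultiplication.MatrixMultiplication.Theorems.SubgroupIdentityDesigns.Negative

variable {p m : ℕ} [Fact p.Prime]

variable (w : Fin m → Fin m → ZMod p)

/-- The weight `w_{ab}` on the `ℓ`-positions (and `0` off them). -/
def smearEpsW (k : ℕ) (i j a b : Fin m) : ZMod p :=
  if (a, b) ∈ ellPos k i j then w a b else 0

/-- The weighted form `ℓ_w(n_e) = Σ_{(b,a) ∈ ellPos} w_{ba} e_{ba}` (outer index the column). -/
def smearEllW (k : ℕ) (i j : Fin m) (e : CMat p m) : ZMod p :=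
  ∑ a : Fin m, ∑ b : Fin m, if (b, a) ∈ ellPos k i j then w b a * e b a else 0

/-- The `w`-twisted phase of one point factorises over the pattern entries. -/
theorem smear_phaseW (k : ℕ) (i j : Fin m) (e M : CMat p m) :
    ZMod.stdAddChar (smearEllW w k i j e) * ZMod.stdAddChar (Matrix.trace (M * (1 + smearNil k i j e))) =
      ZMod.stdAddChar (∑ a : Fin m, M a a) *
        ∏ a : Fin m, ∏ b : Fin m,
          ZMod.stdAddChar (if (b, a) ∈ smearPat k i j then (M a b + smearEpsW w k i j b a) * e b a else 0) := by
  have hsum : smearEllW w k i j e + ∑ a : Fin m, ∑ b : Fin m, (if (b, a) ∈ smearPat k i j then M a b * e b a else 0)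
      = ∑ a : Fin m, ∑ b : Fin m,
          (if (b, a) ∈ smearPat k i j then (M a b + smearEpsW w k i j b a) * e b a else 0) := by
    unfold smearEllW
    rw [← Finset.sum_add_distrib]
    refine Finset.sum_congr rfl fun a _ => ?_
    rw [← Finset.sum_add_distrib]
    refine Finset.sum_congr rfl fun b _ => ?_
    unfold smearEpsW
    by_cases hl : (b, a) ∈ ellPos k i j
    · rw [if_pos hl, if_pos (ellPos_imp_smearPat hl), if_pos (ellPos_imp_smearPat hl), if_pos hl]
      ring
    · rw [if_neg hl, if_neg hl, zero_add]
      split_ifs <;> ring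
  rw [trace_mul_one_add_smearNil, AddChar.map_add_eq_mul, mul_left_comm, ← AddChar.map_add_eq_mul, hsum]
  congr 1
  rw [stdAddChar_map_sum]
  exact Finset.prod_congr rfl fun a _ => stdAddChar_map_sum (p := p) Finset.univ
    (fun b => if (b, a) ∈ smearPat k i j then (M a b + smearEpsW w k i j b a) * e b a else 0)

/-- **Summing over the pattern group** (weighted): `Σ_e ψ(ℓ_w(n_e)) ψ(tr(M(1+n_e))) = ψ(tr M) · Π_{(b,a)} c_{ab}` with
`c = p·[M_ab + w_ba ε_ba = 0]` on pattern positions `(b,a)` and `c = p` elsewhere. -/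
theorem sum_smear_phaseW (k : ℕ) (i j : Fin m) (M : CMat p m) :
    ∑ e : CMat p m, ZMod.stdAddChar (smearEllW w k i j e) *
        ZMod.stdAddChar (Matrix.trace (M * (1 + smearNil k i j e))) =
      ZMod.stdAddChar (∑ a : Fin m, M a a) *
        ∏ a : Fin m, ∏ b : Fin m,
          (if (b, a) ∈ smearPat k i j then (if M a b + smearEpsW w k i j b a = 0 then (p : ℂ) else 0) else (p : ℂ)) := by
  simp_rw [smear_phaseW]
  rw [← Finset.mul_sum]
  congr 1
  set G : Fin m → Fin m → ZMod p → ℂ := fun a b x =>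
    ZMod.stdAddChar (if (b, a) ∈ smearPat k i j then (M a b + smearEpsW w k i j b a) * x else 0) with hG
  have hswap : (∑ e : CMat p m, ∏ a : Fin m, ∏ b : Fin m, G a b (e b a)) =
      ∏ a : Fin m, ∏ b : Fin m, ∑ x : ZMod p, G a b x := by
    calc (∑ e : CMat p m, ∏ a : Fin m, ∏ b : Fin m, G a b (e b a))
        = ∑ e : CMat p m, ∏ b : Fin m, ∏ a : Fin m, G a b (e b a) := by
          refine Finset.sum_congr rfl fun e _ => Finset.prod_comm
      _ = ∑ f : Fin m → Fin m → ZMod p, ∏ b : Fin m, ∏ a : Fin m, G a b (f b a) := by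
          rw [← Equiv.sum_comp Matrix.of]
          rfl
      _ = ∏ b : Fin m, ∑ g : Fin m → ZMod p, ∏ a : Fin m, G a b (g a) :=
          (Fintype.prod_sum (fun b (g : Fin m → ZMod p) => ∏ a : Fin m, G a b (g a))).symm
      _ = ∏ b : Fin m, ∏ a : Fin m, ∑ x : ZMod p, G a b x := by
          refine Finset.prod_congr rfl fun b _ => ?_
          exact (Fintype.prod_sum (fun a (x : ZMod p) => G a b x)).symm
      _ = _ := Finset.prod_comm
  have hG' : ∀ (e : CMat p m) (a b : Fin m),
      ZMod.stdAddChar (if (b, a) ∈ smearPat k i j then (M a b + smearEpsW w k i j b a) * e b a else 0) = G a b (e b a) :=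
    fun e a b => rfl
  simp_rw [hG']
  rw [hswap]
  refine Finset.prod_congr rfl fun a _ => Finset.prod_congr rfl fun b _ => ?_
  by_cases hc : (b, a) ∈ smearPat k i j
  · simp only [hG, if_pos hc]
    rw [sum_psi_mul]
  · simp only [hG, if_neg hc, AddChar.map_zero_eq_one, Finset.sum_const, Finset.card_univ, ZMod.card,
      nsmul_eq_mul, mul_one]

/-- The rank step (weighted): if `M_{ab} = −w_{ba}ε_{ba}` at every pattern position `(b,a)` and `w ≠ 0` on the
`ℓ`-positions, then `rk M ≥ k + 1` (the submatrix rows `(0,…,k-1,j)` × columns `(1,…,k-1,j,i)` is lower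
triangular with non-zero diagonal `−w`). -/
theorem succ_le_rank_of_smear_entriesW (k : ℕ) (i j : Fin m) (hki : k ≤ i.val) (hij : i.val < j.val)
    (hw : ∀ a b : Fin m, (a, b) ∈ ellPos k i j → w a b ≠ 0) (M : CMat p m) (hent : ∀ a b : Fin m, (b, a) ∈ smearPat k i j → M a b = -smearEpsW w k i j b a) :
    k + 1 ≤ M.rank := by
  have hij' : i ≠ j := fun h => by rw [h] at hij; exact lt_irrefl _ hij
  have hjm : j.val < m := j.isLt
  -- index maps of the `(k+1) × (k+1)` minor
  let row : Fin (k + 1) → Fin m := fun r => if h : r.val < k then ⟨r.val, by omega⟩ else j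
  let col : Fin (k + 1) → Fin m := fun c =>
    if h : c.val + 1 < k then ⟨c.val + 1, by omega⟩ else if c.val + 1 = k then j else i
  let S : Matrix (Fin (k + 1)) (Fin (k + 1)) (ZMod p) := M.submatrix row col
  -- its entries on and above the diagonal: zero above, non-zero (namely `-w`) on the diagonal
  have hS : ∀ r c : Fin (k + 1), r.val ≤ c.val → (r ≠ c → S r c = 0) ∧ (r = c → S r c ≠ 0) := by
    intro r c hrc
    show (r ≠ c → M (row r) (col c) = 0) ∧ (r = c → M (row r) (col c) ≠ 0)
    have hr := r.isLt
    have hc := c.isLt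
    by_cases hrk : r.val < k
    · have hrow : row r = ⟨r.val, by omega⟩ := dif_pos hrk
      rw [hrow]
      by_cases hc1 : c.val + 1 < k
      · have hcol : col c = ⟨c.val + 1, by omega⟩ := dif_pos hc1
        rw [hcol]
        have hpat : ((⟨c.val + 1, by omega⟩ : Fin m), (⟨r.val, by omega⟩ : Fin m)) ∈ smearPat k i j :=
          mem_smearPat.2 (Or.inl ⟨by simp; omega, by simp; omega⟩)
        rw [hent _ _ hpat]
        unfold smearEpsW
        refine ⟨fun hreq => ?_, fun hreq => ?_⟩
        · have hrc' : r.val < c.val := lt_of_le_of_ne hrc (fun h => hreq (Fin.ext h))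
          rw [if_neg, neg_zero]
          intro hmem
          rcases mem_ellPos.1 hmem with ⟨h1, _⟩ | ⟨h1, _⟩ | ⟨h1, _⟩
          · simp at h1; omega
          · have := congrArg Fin.val h1; simp at this; omega
          · have := congrArg Fin.val h1; simp at this; omega
        · subst hreq
          have hmem : ((⟨r.val + 1, by omega⟩ : Fin m), (⟨r.val, by omega⟩ : Fin m)) ∈ ellPos k i j :=
            mem_ellPos.2 (Or.inl ⟨by simp, by simp; omega⟩)
          rw [if_pos hmem]
          exact neg_ne_zero.2 (hw _ _ hmem)
      · by_cases hc2 : c.val + 1 = k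
        · have hcol : col c = j := by
            show (if h : c.val + 1 < k then _ else _) = j
            rw [dif_neg hc1, if_pos hc2]
          rw [hcol]
          have hpat : (j, (⟨r.val, by omega⟩ : Fin m)) ∈ smearPat k i j :=
            mem_smearPat.2 (Or.inr (Or.inl ⟨Or.inr rfl, by simp; omega⟩))
          rw [hent _ _ hpat]
          unfold smearEpsW
          refine ⟨fun hreq => ?_, fun hreq => ?_⟩
          · have hrc' : r.val < c.val := lt_of_le_of_ne hrc (fun h => hreq (Fin.ext h))
            rw [if_neg, neg_zero]
            intro hmem
            rcases mem_ellPos.1 hmem with ⟨_, h2⟩ | ⟨_, h2⟩ | ⟨h1, _⟩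
            · omega
            · simp at h2; omega
            · exact hij' h1.symm
          · subst hreq
            have hmem : (j, (⟨r.val, by omega⟩ : Fin m)) ∈ ellPos k i j :=
              mem_ellPos.2 (Or.inr (Or.inl ⟨rfl, by simp; omega⟩))
            rw [if_pos hmem]
            exact neg_ne_zero.2 (hw _ _ hmem)
        · have hck : c.val = k := by omega
          have hcol : col c = i := by
            show (if h : c.val + 1 < k then _ else _) = i
            rw [dif_neg hc1, if_neg hc2]
          rw [hcol]
          have hpat : (i, (⟨r.val, by omega⟩ : Fin m)) ∈ smearPat k i j :=
            mem_smearPat.2 (Or.inr (Or.inl ⟨Or.inl rfl, by simp; omega⟩))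
          rw [hent _ _ hpat]
          unfold smearEpsW
          have hreq : r ≠ c := fun h => by rw [h] at hrk; omega
          refine ⟨fun _ => ?_, fun h => absurd h hreq⟩
          rw [if_neg, neg_zero]
          intro hmem
          rcases mem_ellPos.1 hmem with ⟨_, h2⟩ | ⟨h1, _⟩ | ⟨_, h2⟩
          · omega
          · exact hij' h1
          · have := congrArg Fin.val h2; simp at this; omega
    · have hrk' : r.val = k := by omega
      have hck : c.val = k := by omega
      have hrow : row r = j := dif_neg hrk
      have hcol : col c = i := by
        show (if h : c.val + 1 < k then _ else _) = i
        rw [dif_neg (by omega), if_neg (by omega)]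
      rw [hrow, hcol]
      have hpat : (i, j) ∈ smearPat k i j := mem_smearPat.2 (Or.inr (Or.inr ⟨rfl, rfl⟩))
      rw [hent _ _ hpat]
      unfold smearEpsW
      have hmem : (i, j) ∈ ellPos k i j := mem_ellPos.2 (Or.inr (Or.inr ⟨rfl, rfl⟩))
      refine ⟨fun hne => absurd (Fin.ext (by omega)) hne, fun _ => ?_⟩
      rw [if_pos hmem]
      exact neg_ne_zero.2 (hw _ _ hmem)
  have htri : S.BlockTriangular OrderDual.toDual := by
    intro r c hlt
    have hlt' : r < c := by simpa using hlt
    exact (hS r c (le_of_lt hlt')).1 (ne_of_lt hlt')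
  have hdet : S.det ≠ 0 := by
    rw [Matrix.det_of_lowerTriangular S htri]
    exact Finset.prod_ne_zero_iff.2 fun r _ => (hS r r le_rfl).2 rfl
  have hunit : IsUnit S := (Matrix.isUnit_iff_isUnit_det _).2 (isUnit_iff_ne_zero.2 hdet)
  have hrank : S.rank = k + 1 := by
    rw [Matrix.rank_of_isUnit _ hunit, Fintype.card_fin]
  calc k + 1 = S.rank := hrank.symm
    _ ≤ M.rank := Matrix.rank_submatrix_le M row col

/-- **WEIGHTED ROOT-SMEAR SUM VANISHES ON LEVEL `k`.** For every `M` of rank `≤ k` and every weight `w`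
non-zero on the `ℓ`-positions: `Σ_e ψ(ℓ_w(n_e)) ψ(tr(M (1 + n_e))) = 0`. -/
theorem rootSmearW_sum_eq_zero (k : ℕ) (i j : Fin m) (hki : k ≤ i.val) (hij : i.val < j.val)
    (hw : ∀ a b : Fin m, (a, b) ∈ ellPos k i j → w a b ≠ 0) (M : CMat p m) (hM : M.rank ≤ k) :
    ∑ e : CMat p m, ZMod.stdAddChar (smearEllW w k i j e) *
        ZMod.stdAddChar (Matrix.trace (M * (1 + smearNil k i j e))) = 0 := by
  rw [sum_smear_phaseW]
  by_contra hne
  have hent : ∀ a b : Fin m, (b, a) ∈ smearPat k i j → M a b = -smearEpsW w k i j b a := by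
    intro a b hp
    have hzero : M a b + smearEpsW w k i j b a = 0 := by
      by_contra hM'
      apply hne
      apply mul_eq_zero_of_right
      apply Finset.prod_eq_zero (Finset.mem_univ a)
      apply Finset.prod_eq_zero (Finset.mem_univ b)
      rw [if_pos hp, if_neg hM']
    exact eq_neg_of_add_eq_zero_left hzero
  have := succ_le_rank_of_smear_entriesW w k i j hki hij hw M hent
  omega

/-- **The `w`-twisted sum of a level-`k` function over the pattern group vanishes.** -/
theorem rootSmearW_fourierMat_sum_eq_zero (k : ℕ) (i j : Fin m) (hki : k ≤ i.val) (hij : i.val < j.val)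
    (hw : ∀ a b : Fin m, (a, b) ∈ ellPos k i j → w a b ≠ 0) (c : CMat p m → ℂ) (hc : ∀ M : CMat p m, k < M.rank → c M = 0) :
    ∑ e : CMat p m, ZMod.stdAddChar (smearEllW w k i j e) * fourierMat c (1 + smearNil k i j e) = 0 := by
  unfold fourierMat
  simp_rw [Finset.mul_sum]
  rw [Finset.sum_comm]
  refine Finset.sum_eq_zero fun M _ => ?_
  have : ∀ e : CMat p m, ZMod.stdAddChar (smearEllW w k i j e) *
      (c M * ZMod.stdAddChar (Matrix.trace (M * (1 + smearNil k i j e)))) =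
      c M * (ZMod.stdAddChar (smearEllW w k i j e) *
        ZMod.stdAddChar (Matrix.trace (M * (1 + smearNil k i j e)))) := fun e => by ring
  simp_rw [this]
  rw [← Finset.mul_sum]
  by_cases hr : M.rank ≤ k
  · rw [rootSmearW_sum_eq_zero w k i j hki hij hw M hr, mul_zero]
  · rw [hc M (by omega), zero_mul]

/-- **NO LEVEL-`k` IDENTITY TEST ON A SET CONTAINING THE PATTERN GROUP** (weighted form; any admissible `w`,
e.g. `w ≡ 1`, gives the contradiction). -/
theorem no_idTest_of_rootSmearW (k : ℕ) (i j : Fin m) (hki : k ≤ i.val) (hij : i.val < j.val)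
    (hw : ∀ a b : Fin m, (a, b) ∈ ellPos k i j → w a b ≠ 0) (S : Set (CMat p m)) (hS : ∀ e : CMat p m, 1 + smearNil k i j e ∈ S)
    (c : CMat p m → ℂ) (hc : ∀ M : CMat p m, k < M.rank → c M = 0)
    (h1 : fourierMat c 1 = 1) (h0 : ∀ s ∈ S, s ≠ 1 → fourierMat c s = 0) : False := by
  have hsum := rootSmearW_fourierMat_sum_eq_zero w k i j hki hij hw c hc
  -- each term is `[n_e = 0]`
  have hval : ∀ e : CMat p m, ZMod.stdAddChar (smearEllW w k i j e) * fourierMat c (1 + smearNil k i j e) =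
      if smearNil k i j e = 0 then 1 else 0 := by
    intro e
    by_cases he : smearNil k i j e = 0
    · have hℓ : smearEllW w k i j e = 0 := by
        unfold smearEllW
        refine Finset.sum_eq_zero fun a _ => Finset.sum_eq_zero fun b _ => ?_
        by_cases hl : (b, a) ∈ ellPos k i j
        · rw [if_pos hl]
          have := congrFun (congrFun he b) a
          simp only [smearNil, Matrix.of_apply, if_pos (ellPos_imp_smearPat hl), Matrix.zero_apply] at this
          rw [this, mul_zero]
        · rw [if_neg hl]
      rw [if_pos he, he, add_zero, hℓ, AddChar.map_zero_eq_one, h1, one_mul]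
    · have hne1 : (1 : CMat p m) + smearNil k i j e ≠ 1 := fun h => he (by simpa using h)
      rw [if_neg he, h0 _ (hS e) hne1, mul_zero]
  simp_rw [hval] at hsum
  rw [Finset.sum_ite, Finset.sum_const_zero, add_zero, Finset.sum_const, nsmul_eq_mul, mul_one] at hsum
  have hpos : 0 < (Finset.univ.filter fun e : CMat p m => smearNil k i j e = 0).card :=
    Finset.card_pos.2 ⟨0, by simp [smearNil]; rfl⟩
  exact absurd hsum (Nat.cast_ne_zero.2 hpos.ne')

end Summit.MatrixMultiplication.MatrixMultiplication.Theorems.SubgroupIdentityDesigns.Negative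

end
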